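import Summits.QuantumFields.BalabanUV.T4Continuum.Support.ShellMeasureLandauHolonomyChart

/-!
# `T4Continuum.ShellMeasureLandauHolonomyToy` — NON-VACUITY OF THE S22 CHAIN WITH A LIVE SHELL AND (SM):
# every binder of `ShellMeasureLandauHolonomyChart.hAN_landau_chartRay` jointly inhabited on a one-dimensional model,
# the canonical objects `solAt`/`corrAt` evaluated, a shell point INSIDE the window, and END-II's (SM) — all at once
(cell `pub-balaban`, sub-cell `t4`, spine estimate NE7c (node U5b); NE7c formalisation swarm, crew seat
`b2b-balaban-t4-ne7c-formalise-leaf-02` gen 3 — the non-vacuity certificate of this lineage's files 7′/7″ (p212141,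
p212418) in the genre of S10 `ShellMeasureRootCompositionToy`, `…SyncToy`, `…WilsonToy`; imports file 7″
`ShellMeasureLandauHolonomyChart` ONLY; two DATA `def`s (`toyΦ`, `toyZ` — the model's coarse-field map and exponent field;
async audit D-0009), 0 `def … : Prop`, 0 sorry; a TOY — nothing about Bałaban's minimiser is asserted)

HONEST FRAMING.  Finite four-torus programme, rung (B)+1 only — NOT infinite volume, NOT a mass gap, NOT the Clay
problem, NOT summit progress.  NE7c (`T4IndicatorShell.ShellWeightBound`) is NOT PRINTED and NOT PROVED; «NE7c ⇐ the
named binders».  A toy model certifies that a list of binder SHAPES is jointly satisfiable; it discharges nothing.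

THE MODEL (chart dimension `n = 1`, every Banach space `ℂ`, `A = ℂ`, one plaquette, one read-out `ℓ = id`, `κ = 1`):
propagator `𝒢 = id` (`B₀ = 1`), nonlinearity `W = 0` (`C₄ = 0`, `a₃ = 1`), current `J = 0`, `Λ = 0`; coarse-field map
`Φ z = z₀/10⁴` on the polydisc `‖z‖ < r_Φ = 200` (`b = 1/50`), `H₁ = id`; Sect. C nonlinearity `C Z = Z²` (`C₂ = 1`,
`R = 1`), scaling `ι = id`, `H = id`; `ε₄ = 10⁻³`; window `W = closedBall 0 1` (`S = 1`).  Every numeric side condition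
of the chain holds: (118)/(121) `2(ε₄+b) ≤ a₃`, `B₀C₄(ε₄+b)² ≤ ε₄`, `4B₀C₄(ε₄+b) < 1`; (54) `9C₂B₀(ε₄+b) = 0.189 < 1`,
`3(ε₄+b) ≤ R`; `S < r_Φ`.
* §1 the data inhabit the binders (`toy_prop4`, `toy_chartMap`, `toy_sectC`).
* §2 `toy_hAN` — `hAN_landau_chartRay` FIRES: END-II's `hAN` on the disc `‖w‖ < 200` for the DEFINED holonomy
  `hol y = exp (Y(y) − D(Y(y)))`, `Y(y) = solAt … (Φ (cplx y)) + Φ (cplx y)`, `D = corrAt …`, with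
  `H_AN = e^{(ε₄+b) + 4(ε₄+b)²} − 1 = e^{0.022764} − 1`.
* §3 the canonical objects EVALUATED (`toyZ_eq`): `toy_solAt` (`solAt … 𝔄 = 0`: with `W = 0`, `J = 0` the zero configuration is
  the unique solution), `toy_corrAt_le` (`‖D(10⁻⁴)‖ ≤ 4·10⁻⁸`, (55) via `corrAt_along`), `toy_hol` (`hol x₀ =
  exp (10⁻⁴ − D(10⁻⁴))` at the window point `x₀ = 1`).
* §4 A LIVE SHELL POINT INSIDE THE WINDOW (`toy_live`): with `θ = 10⁻⁴`, `ρ = 1/4`: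
  `θ(1−ρ) = 0.75·10⁻⁴ ≤ ‖hol x₀ − 1‖` (`‖e^w − 1‖ ≥ ‖w‖ − ‖w‖²`, `‖w‖ ≥ 10⁻⁴ − 4·10⁻⁸`).
* §5 (SM) HOLDS (`toy_SM`): `36·H_AN/(200 − 1)² ≤ δ·θ` with `δ = 1/2` (`e^{s} − 1 ≤ s + s²`, Mathlib).
§2 + §4 + §5 (with `0 < θ`, `0 ≤ δ < 1`, `ρ ≤ (1−δ)/2`) are EXACTLY the hypotheses of this lineage's
`ShellMeasureRadiusDemand.radius_demand_of_witness` (proposed p212576; not imported here): the S22 binders, a live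
shell and (SM) coexist — here at `r_Φ/S = 200 > 7`, as that diagnostic demands.
WHAT THIS SHOWS.  The hypothesis lists of files 7′/7″ (hence of S14 §1, S22 f2 §1, `B11Prop6Scheme`,
`B13Contraction113` as consumed) are jointly satisfiable TOGETHER WITH a non-empty shell in the window and END-II's
(SM) — the chain is not vacuity-prone in the sense of T-NE7c-4 and T-NE7c-5; and the `Classical.epsilon` definitions `solAt`,
`corrAt` compute what they should on a model.  Nothing else.  NE7c NOT PROVED; spine PROVED 0/9.  HONEST DEPENDENCY
(cell): continuum YM on T⁴ ⇐ BetaPertH ∧ nine spine estimates (0/9 proved); BetaPertH ⇐ (D1) ∧ (D4) ∧ CAP+tail;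
G-an2-4 gates asym, D1 and NE2/3/4.
-/

noncomputable section

open Set Metric NormedSpace

namespace Summit.QuantumFields.BalabanUV.T4Continuum.ShellMeasureLandauHolonomyToy

open Literature.MathematicalPhysics.QuantumFieldTheory.Balaban1983to89
open B11Prop6Scheme (mapT Prop4Hyp)
open ShellMeasureWilsonWords (wordExp)
open ShellMeasureLandauHolonomy (solAt corrAt landauExp solAt_eq_of_unique corrAt_along landauExp_apply)
open ShellMeasureLandauHolonomyChart (holOf cplx holOf_apply hAN_landau_chartRay)

/-- the toy coarse-field map `Φ z = z₀ / 10⁴` on `Fin 1 → ℂ`. A function, not a proposition. [folklore] -/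
def toyΦ (z : Fin 1 → ℂ) : ℂ := (1 / 10000 : ℂ) * z 0

/-- `toyΦ` unfolded. [folklore] -/
@[simp] theorem toyΦ_apply (z : Fin 1 → ℂ) : toyΦ z = (1 / 10000 : ℂ) * z 0 := rfl

/-- the toy's canonical Landau exponent field on the chart (file 7″ §3's `fun y => landauExp … (solAt … + …)` at the
model data: `C Z = Z²`, `ι = H = H₁ = 𝒢 = id`, `W = 0`, `Λ = 0`, `J = 0`, `ε₄ = 10⁻³`, `r = 4·(ε₄ + b)²`).
A function, not a proposition. [folklore] -/
def toyZ (y : Fin 1 → ℝ) : ℂ :=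
  landauExp (fun Z : ℂ => Z ^ 2) (ContinuousLinearMap.id ℂ ℂ) (ContinuousLinearMap.id ℂ ℂ)
    (4 * 1 * (1 / 1000 + 1 * (1 / 50)) ^ 2)
    (solAt (ContinuousLinearMap.id ℂ ℂ) 0 (fun _ : ℂ => (0 : ℂ)) (1 / 1000) (0 : ℂ)
      ((ContinuousLinearMap.id ℂ ℂ) (toyΦ (cplx y))) + (ContinuousLinearMap.id ℂ ℂ) (toyΦ (cplx y)))

/-! ## §1 The data inhabit the binders -/

/-- (P4) for `W = 0`: `C₄ = 0`, `a₃ = 1`. [folklore] -/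
theorem toy_prop4 : Prop4Hyp (fun _ : ℂ => (0 : ℂ)) 0 1 where
  quad Y _ := by simp
  differentiableOn := differentiableOn_const _

/-- (P2)/(46)/(103)/scaling for the identity: `‖id f‖ ≤ 1·‖f‖`. [folklore] -/
theorem toy_id_bound : ∀ f : ℂ, ‖(ContinuousLinearMap.id ℂ ℂ) f‖ ≤ 1 * ‖f‖ := fun f => by simp

/-- (75) TYPE for the toy chart map: holomorphic on the polydisc `‖z‖ < 200`, `Φ 0 = 0`, `‖Φ z‖ < 1/50` there.
[folklore] -/
theorem toy_chartMap : DifferentiableOn ℂ toyΦ (ball 0 200) ∧ toyΦ 0 = 0 ∧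
    ∀ z ∈ ball (0 : Fin 1 → ℂ) 200, ‖toyΦ z‖ < 1 / 50 := by
  refine ⟨fun z _ => ?_, by simp, fun z hz => ?_⟩
  · exact (((differentiable_const _).mul (differentiable_pi.1 differentiable_id 0)).differentiableAt).congr_of_eventuallyEq
      (Filter.Eventually.of_forall fun w => toyΦ_apply w) |>.differentiableWithinAt
  rw [mem_ball_zero_iff] at hz
  have h0 : ‖z 0‖ ≤ ‖z‖ := norm_le_pi_norm z 0
  rw [toyΦ_apply, norm_mul]
  have : ‖(1 / 10000 : ℂ)‖ = 1 / 10000 := by simp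
  rw [this]
  linarith

/-- (44)+[4] Prop. 7 TYPE for `C Z = Z²`: `C₂ = 1` on `‖Z‖ < 1`, entire. [folklore] -/
theorem toy_sectC : (∀ Z : ℂ, ‖Z‖ < 1 → ‖Z ^ 2‖ ≤ 1 * ‖Z‖ ^ 2) ∧
    DifferentiableOn ℂ (fun Z : ℂ => Z ^ 2) (ball 0 1) :=
  ⟨fun Z _ => by rw [norm_pow, one_mul], (differentiable_pow 2).differentiableOn⟩

/-! ## §2 END-II's `hAN` fires on the model -/

/-- **`hAN_landau_chartRay` FIRES**: every binder inhabited (`S = 1`, `r_Φ = 200`, `B₀ = 1`, `C₄ = 0`, `a₃ = 1`,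
`b = 1/50`, `ε₄ = 10⁻³`, `C₂ = 1`, `R = 1`, `κ = 1`, `m = 1`), conclusion = END-II's `hAN` on the disc `‖w‖ < 200`
for the DEFINED holonomy `holOf [id] toyZ` (`toyZ` = 7″ §3's exponent field at the model data, by `rfl`).
[folklore] -/
theorem toy_hAN :
    ∀ x ∈ closedBall (0 : Fin 1 → ℝ) 1, ∀ p ∈ ({()} : Finset Unit), ∃ f : ℂ → ℂ,
      DifferentiableOn ℂ f (ball 0 (200 / 1)) ∧
      (∀ w ∈ ball (0 : ℂ) (200 / 1), ‖f w‖ ≤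
        Real.exp ((1 : ℕ) * (1 * ((1 / 1000 + 1 * (1 / 50)) + 1 * (4 * 1 * (1 / 1000 + 1 * (1 / 50)) ^ 2)))) - 1) ∧
      f 0 = 0 ∧ ∀ c : ℝ, 0 ≤ c → c ≤ 1 → f (c : ℂ) = holOf [(ContinuousLinearMap.id ℂ ℂ)] toyZ (c • x) - 1 := by
  obtain ⟨hΦd, hΦ0, hΦ⟩ := toy_chartMap
  obtain ⟨hCq, hCd⟩ := toy_sectC
  exact hAN_landau_chartRay (𝔭 := Unit) (Pu := {()}) one_pos subset_rfl toy_id_bound toy_prop4 one_pos le_rfl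
    (b := 1 / 50) (ε₄ := 1 / 1000) (by norm_num) (by norm_num) (by norm_num) (by norm_num) (ContinuousLinearMap.id ℂ ℂ) toy_id_bound
    hΦd hΦ0 hΦ (by norm_num) (C₂ := 1) (R := 1) zero_le_one hCq hCd (ContinuousLinearMap.id ℂ ℂ) (fun Y => by simp) (ContinuousLinearMap.id ℂ ℂ) toy_id_bound
    (by norm_num) (by norm_num) (fun _ => [(ContinuousLinearMap.id ℂ ℂ)]) zero_le_one (fun _ _ ℓ hℓ Y => by
      rw [List.mem_singleton] at hℓ; subst hℓ; simp) (m := 1) (fun _ _ => by simp)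

/-! ## §3 The canonical objects evaluated -/

/-- with `W = 0`, `J = 0`, `Λ = 0` the zero configuration is THE solution: `solAt id 0 0 ε₄ 0 𝔄 = 0`. [folklore] -/
theorem toy_solAt (𝔄 : ℂ) : solAt (ContinuousLinearMap.id ℂ ℂ) 0 (fun _ : ℂ => (0 : ℂ)) (1 / 1000) (0 : ℂ) 𝔄 = 0 := by
  have hT : ∀ X : ℂ, mapT (ContinuousLinearMap.id ℂ ℂ) 0 (fun _ : ℂ => (0 : ℂ)) (0 : ℂ) 𝔄 X = 0 := fun X => by
    simp [B11Prop6Scheme.mapT_apply]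
  exact solAt_eq_of_unique (by norm_num) (hT 0) fun X' _ hfix => by rw [← hfix, hT]

/-- the exponent field at a chart point: `toyZ y = 𝔄 − D(𝔄)` with `𝔄 = Φ (cplx y) = y₀/10⁴`. [folklore] -/
theorem toyZ_eq (y : Fin 1 → ℝ) :
    toyZ y = (1 / 10000 : ℂ) * (y 0 : ℂ) -
      corrAt (fun Z : ℂ => Z ^ 2) (ContinuousLinearMap.id ℂ ℂ) (ContinuousLinearMap.id ℂ ℂ)
        (4 * 1 * (1 / 1000 + 1 * (1 / 50)) ^ 2) ((1 / 10000 : ℂ) * (y 0 : ℂ)) := by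
  simp only [toyZ, landauExp_apply, toy_solAt, zero_add, ContinuousLinearMap.coe_id', id_eq, cplx, toyΦ_apply]

/-- **(55) at the window point**: `‖D(10⁻⁴)‖ ≤ 4·‖10⁻⁴‖²` — the canonical correction bounded through `corrAt_along`
(constant curve, (54)-smallness `9·0.021 < 1`, `3·0.021 ≤ 1`). [folklore] -/
theorem toy_corrAt_le :
    ‖corrAt (fun Z : ℂ => Z ^ 2) (ContinuousLinearMap.id ℂ ℂ) (ContinuousLinearMap.id ℂ ℂ) (4 * 1 * (1 / 1000 + 1 * (1 / 50) : ℝ) ^ 2) (1 / 10000 : ℂ)‖ ≤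
      4 * 1 * ‖(ContinuousLinearMap.id ℂ ℂ) (1 / 10000 : ℂ)‖ ^ 2 := by
  obtain ⟨hCq, hCd⟩ := toy_sectC
  have h := corrAt_along (Rad := 1) zero_le_one hCq hCd (ContinuousLinearMap.id ℂ ℂ) (fun Y => by simp) (ContinuousLinearMap.id ℂ ℂ) zero_le_one toy_id_bound
    (ε := (1 / 1000 + 1 * (1 / 50) : ℝ)) (by norm_num) (by norm_num) (Y := fun _ : ℂ => (1 / 10000 : ℂ))
    (differentiableOn_const _) (fun _ _ => by norm_num)
  exact (h.2 0 (mem_ball_self one_pos)).2.2.2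

/-- the holonomy at the window point `x₀ = 1`: `hol x₀ = exp (10⁻⁴ − D(10⁻⁴))`. [folklore] -/
theorem toy_hol :
    holOf [(ContinuousLinearMap.id ℂ ℂ)] toyZ (fun _ : Fin 1 => (1 : ℝ)) =
      exp ((1 / 10000 : ℂ) - corrAt (fun Z : ℂ => Z ^ 2) (ContinuousLinearMap.id ℂ ℂ) (ContinuousLinearMap.id ℂ ℂ)
        (4 * 1 * (1 / 1000 + 1 * (1 / 50)) ^ 2) (1 / 10000 : ℂ)) := by
  rw [holOf_apply, toyZ_eq]
  simp only [List.map_cons, List.map_nil, wordExp, List.prod_cons, List.prod_nil, mul_one,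
    ContinuousLinearMap.coe_id', id_eq, Complex.ofReal_one]

/-! ## §4 A live shell point inside the window -/

/-- `‖e^w − 1‖ ≥ ‖w‖ − ‖w‖²` for `‖w‖ ≤ 1` (Mathlib's `Complex.norm_exp_sub_one_sub_id_le`). [folklore] -/
theorem norm_exp_sub_one_ge {w : ℂ} (hw : ‖w‖ ≤ 1) : ‖w‖ - ‖w‖ ^ 2 ≤ ‖exp w - 1‖ := by
  have h := Complex.norm_exp_sub_one_sub_id_le hw
  rw [Complex.exp_eq_exp_ℂ] at h
  have htri : ‖w‖ ≤ ‖exp w - 1‖ + ‖exp w - 1 - w‖ := by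
    have := norm_sub_le (exp w - 1) (exp w - 1 - w)
    rwa [sub_sub_cancel] at this
  linarith

/-- **A LIVE SHELL POINT IN THE WINDOW.**  With `θ = 10⁻⁴`, `ρ = 1/4`: the window point `x₀ = 1`
(`‖x₀‖ ≤ S = 1`) satisfies `θ(1−ρ) ≤ ‖hol x₀ − 1‖` — the threshold scale is REACHED inside `W`, so END-II's (M1) is
not vacuous there (cf. `ShellMeasureRadiusDemand` §2). [folklore] -/
theorem toy_live : ∃ x ∈ closedBall (0 : Fin 1 → ℝ) 1, ∃ p ∈ ({()} : Finset Unit),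
    (1 / 10000 : ℝ) * (1 - 1 / 4) ≤ ‖holOf [(ContinuousLinearMap.id ℂ ℂ)] toyZ x - 1‖ := by
  refine ⟨fun _ => 1, ?_, (), Finset.mem_singleton_self _, ?_⟩
  · rw [mem_closedBall_zero_iff]
    exact (pi_norm_le_iff_of_nonneg zero_le_one).2 fun _ => by simp
  rw [toy_hol]
  set D := corrAt (fun Z : ℂ => Z ^ 2) (ContinuousLinearMap.id ℂ ℂ) (ContinuousLinearMap.id ℂ ℂ) (4 * 1 * (1 / 1000 + 1 * (1 / 50) : ℝ) ^ 2) (1 / 10000 : ℂ) with hD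
  have hDle : ‖D‖ ≤ 4 / 100000000 := by
    have h := toy_corrAt_le
    have hn : ‖(ContinuousLinearMap.id ℂ ℂ) (1 / 10000 : ℂ)‖ = 1 / 10000 := by simp
    rw [hn] at h
    have h4 : (4 : ℝ) * 1 * (1 / 10000) ^ 2 = 4 / 100000000 := by norm_num
    rw [h4] at h
    exact h
  have hA : ‖(1 / 10000 : ℂ)‖ = 1 / 10000 := by simp
  -- the exponent `w = 10⁻⁴ − D`
  have hlo : 1 / 10000 - 4 / 100000000 ≤ ‖(1 / 10000 : ℂ) - D‖ := by
    have := norm_sub_norm_le (1 / 10000 : ℂ) D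
    rw [hA] at this
    linarith
  have hhi : ‖(1 / 10000 : ℂ) - D‖ ≤ 1 / 10000 + 4 / 100000000 := by
    have := norm_sub_le (1 / 10000 : ℂ) D
    rw [hA] at this
    linarith
  have hw1 : ‖(1 / 10000 : ℂ) - D‖ ≤ 1 := by linarith
  have hge := norm_exp_sub_one_ge hw1
  have hsq : ‖(1 / 10000 : ℂ) - D‖ ^ 2 ≤ (1 / 10000 + 4 / 100000000) ^ 2 :=
    pow_le_pow_left₀ (norm_nonneg _) hhi 2
  nlinarith

/-! ## §5 (SM) holds -/

/-- **(SM) ON THE MODEL**: `36·H_AN/(200/1 − 1)² ≤ δ·θ` with `H_AN = e^{0.022764} − 1`, `δ = 1/2`, `θ = 10⁻⁴`.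
[folklore] -/
theorem toy_SM :
    36 * (Real.exp ((1 : ℕ) * (1 * ((1 / 1000 + 1 * (1 / 50)) + 1 * (4 * 1 * (1 / 1000 + 1 * (1 / 50)) ^ 2)))) - 1) /
        (200 / 1 - 1) ^ 2 ≤ (1 / 2) * (1 / 10000 : ℝ) := by
  have hs : ((1 : ℕ) : ℝ) * (1 * ((1 / 1000 + 1 * (1 / 50)) + 1 * (4 * 1 * (1 / 1000 + 1 * (1 / 50)) ^ 2))) =
      5691 / 250000 := by norm_num
  rw [hs, div_le_iff₀ (by norm_num : (0 : ℝ) < (200 / 1 - 1) ^ 2)]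
  -- `e^s − 1 ≤ s + s²` for `|s| ≤ 1` (Mathlib's `Real.abs_exp_sub_one_sub_id_le`)
  have h := (abs_le.1 (Real.abs_exp_sub_one_sub_id_le (x := (5691 / 250000 : ℝ))
    (by rw [abs_of_nonneg (by norm_num)]; norm_num))).2
  nlinarith

end Summit.QuantumFields.BalabanUV.T4Continuum.ShellMeasureLandauHolonomyToy
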